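import Summits.ABC.ABC.Theses.DefiniteXi
import HarnessLib

/-!
# Stub-ideation k2, generation 6 (FAMILY 2 — RESHAPE) — `stub_primeToSixDegreeBound` (P6)
# crux `DefiniteXi.SteinbergCore` (stmt-ABC-15024), line `p6_tamagawa_split`

Gen 6 adds ONE typed statement to gens 2–5 (`…StubIdeas2G2/G3/G4/G5`, kept by reference): the
WEAKEST CONSEQUENCE of the stub in its own currency — every prime `ℓ ∤ 6` dividing the degree of a
minimal Frey datum is `≤ C_ε N^{2+ε}` (`FreyCpsPrimeBound`, the Frey/minimal/`ℓ ∤ 6` slice, at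
`κ = 2 + ε`, of the OPEN crux `IsogenyGlueCongruence.DegreePrimesPolyBounded`, stmt-ABC-2045) — and
the proved calibration `Stub → FreyCpsPrimeBound` (sup ≤ product).  It records where the
"weaken-and-bootstrap" reshaping lands: the weakening is another route's open crux (known only for
congruence partners of bounded dimension, Gaudron–Rémond), and no sup → product bootstrap exists.
-/

noncomputable section

set_option linter.dupNamespace false

namespace Summit.ABC.ABC.Cruxes.SteinbergCore.StubIdeas2G6

open Literature.NumberTheory.EllipticCurves Literature.NumberTheory.EllipticCurves.ModularForms
open Summit.ABC.ABC.Theses.DefiniteXi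

/-- The registered stub, verbatim. [folklore] -/
def Stub : Prop :=
  ∀ ε : ℝ, 0 < ε → ∃ C : ℝ, ∀ a b : ℤ, IsCoprime a b → a * b * (a + b) ≠ 0 → ∀ (N : ℕ) [NeZero N],
    (freyCurve a b).conductorNorm ℤ = N →
    ∀ D : ModularParametrizationData (freyCurve a b) N,
      (∀ D' : ModularParametrizationData (freyCurve a b) N, D.deg ≤ D'.deg) →
      ((D.deg / (ordProj[2] D.deg * ordProj[3] D.deg) : ℕ) : ℝ) ≤ C * (N : ℝ) ^ (2 + ε)

/-- **FreyCpsPrimeBound** — the weakest consequence of P6 in its own currency (sup instead of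
product): every prime `ℓ ≠ 2, 3` dividing the degree of a MINIMAL Frey datum at level `N = conductor`
is `≤ C_ε · N^{2+ε}`.  This is the Frey-curve / minimal-datum / `ℓ ∤ 6` slice, at exponent
`κ = 2 + ε`, of crux `Summit.ABC.ABC.Theses.IsogenyGlueCongruence.DegreePrimesPolyBounded`
(stmt-ABC-2045, OPEN; unconditionally known only for congruence partners of bounded dimension,
Gaudron–Rémond 2023, exponent `2 + 2d₀`). [folklore] -/
def FreyCpsPrimeBound : Prop :=
  ∀ ε : ℝ, 0 < ε → ∃ C : ℝ, ∀ a b : ℤ, IsCoprime a b → a * b * (a + b) ≠ 0 → ∀ (N : ℕ) [NeZero N],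
    (freyCurve a b).conductorNorm ℤ = N →
    ∀ D : ModularParametrizationData (freyCurve a b) N,
      (∀ D' : ModularParametrizationData (freyCurve a b) N, D.deg ≤ D'.deg) →
      ∀ ℓ : ℕ, ℓ.Prime → ℓ ≠ 2 → ℓ ≠ 3 → ℓ ∣ D.deg → (ℓ : ℝ) ≤ C * (N : ℝ) ^ (2 + ε)

/-- The 6-part `2^{v₂ n} · 3^{v₃ n}` divides `n`. [folklore] -/
theorem sixPart_dvd (n : ℕ) : ordProj[2] n * ordProj[3] n ∣ n := by
  have h2 : ordProj[2] n ∣ n := Nat.ordProj_dvd n 2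
  have h3 : ordProj[3] n ∣ n := Nat.ordProj_dvd n 3
  have hcop : Nat.Coprime (ordProj[2] n) (ordProj[3] n) :=
    Nat.Coprime.pow _ _ (by norm_num)
  exact Nat.Coprime.mul_dvd_of_dvd_of_dvd hcop h2 h3

/-- A prime `ℓ ≠ 2, 3` dividing `n` divides the prime-to-6 part of `n`. [folklore] -/
theorem dvd_primeToSix_of_dvd {ℓ n : ℕ} (hℓ : ℓ.Prime) (h2 : ℓ ≠ 2) (h3 : ℓ ≠ 3) (hdvd : ℓ ∣ n) :
    ℓ ∣ n / (ordProj[2] n * ordProj[3] n) := by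
  have hs : ordProj[2] n * ordProj[3] n ∣ n := sixPart_dvd n
  have hc2 : Nat.Coprime ℓ 2 := (Nat.coprime_primes hℓ Nat.prime_two).mpr h2
  have hc3 : Nat.Coprime ℓ 3 := (Nat.coprime_primes hℓ Nat.prime_three).mpr h3
  have hcop : Nat.Coprime ℓ (ordProj[2] n * ordProj[3] n) :=
    Nat.Coprime.mul_right (hc2.pow_right _) (hc3.pow_right _)
  have h' : ℓ ∣ n / (ordProj[2] n * ordProj[3] n) * (ordProj[2] n * ordProj[3] n) := by
    rwa [Nat.div_mul_cancel hs]
  exact hcop.dvd_of_dvd_mul_right h'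

/-- **Calibration (PROVED): the stub gives its sup-norm weakening** — `ℓ ∣ cps(deg D)`, and
`cps(deg D) ≥ 1` because `deg D > 0`, so `ℓ ≤ cps(deg D) ≤ C N^{2+ε}`.  The converse (sup → product)
has no engine: it is the content of P6. [folklore] -/
theorem freyCpsPrimeBound_of_stub (h : Stub) : FreyCpsPrimeBound := by
  intro ε hε
  obtain ⟨C, hC⟩ := h ε hε
  refine ⟨C, fun a b hab h0 N _ hN D hmin ℓ hℓ h2 h3 hdvd => ?_⟩
  have key : ℓ ∣ D.deg / (ordProj[2] D.deg * ordProj[3] D.deg) := dvd_primeToSix_of_dvd hℓ h2 h3 hdvd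
  have hpos : 0 < D.deg / (ordProj[2] D.deg * ordProj[3] D.deg) :=
    Nat.div_pos (Nat.le_of_dvd D.deg_pos (sixPart_dvd D.deg)) (by positivity)
  have hle : ℓ ≤ D.deg / (ordProj[2] D.deg * ordProj[3] D.deg) := Nat.le_of_dvd hpos key
  calc (ℓ : ℝ) ≤ ((D.deg / (ordProj[2] D.deg * ordProj[3] D.deg) : ℕ) : ℝ) := by exact_mod_cast hle
    _ ≤ C * (N : ℝ) ^ (2 + ε) := hC a b hab h0 N hN D hmin

end Summit.ABC.ABC.Cruxes.SteinbergCore.StubIdeas2G6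

end
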